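import Summits.Schanuel.Schanuel.Theorems.ZilberEacParamCurveLogRayRootsPos
import Summits.Schanuel.Schanuel.Theorems.ZilberEacParamCurveEscapeLog
import Summits.Schanuel.Schanuel.Theorems.ZilberEacFibreCurveZerosEdge
import HarnessLib

/-!
# Polynomially parametrised base curves, XLVIII: zeros of `Σ_j q_j(t) e^{e_j R(t)}` on a root
# direction with the LIMIT of the value: `Re R(t_k) - μ log ‖t_k‖ → log ‖θ‖`

HONEST FRAMING.  Cell `pub-schanuel` (Zilber's Exponential-Algebraic Closedness, case ladder;
host summit Schanuel), seat 2, gen 21.  The engine of files XXIX/XXXVIII once more, with the zero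
`u_k` of the rescaled function in the local coordinate chosen of MINIMAL norm among the zeros in
the closed unit ball; since zeros exist in every ball `‖u‖ < ε` for large `k` (persistence at
every radius), `u_k → 0`, hence `R(t_k) - R(z₀(k)) = u_k + O(1/‖z₀(k)‖) → 0` and
`Re R(t_k) - μ log ‖t_k‖ → log ‖θ‖` (`exists_zeros_log_dir_lim`; also `‖t_k‖ → ∞`).  This is the
input of the horizontal-edge (`μ = 0`) analysis below the Puiseux gap, where the order
`‖t‖^{n-d} log ‖t‖` is absent and the coefficient of `‖t‖^{n-d}` involves `log ‖θ‖` (the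
equimodular functional, as over graphs in gen 18).  Mantova–Masser's question is OPEN in general
(PLMS 2024 §1 p. 5); NOT Schanuel's conjecture (neither used nor implied; EAC ⇏ SC); `EC(3,2)`
stays OPEN.
-/

noncomputable section

open Filter Topology Metric Set Complex Polynomial
open Literature.ModelTheory.Zilber

set_option linter.dupNamespace false

namespace Summit.Schanuel.Schanuel.Theorems

/-- **Zeros on a root direction with the limit of `Re R - μ log ‖·‖`.**  See the module
docstring. (new) -/
theorem exists_zeros_log_dir_lim {ι : Type*} (R : Polynomial ℂ) (hd : 2 ≤ R.natDegree)
    (J : Finset ι) (q : ι → Polynomial ℂ) (e : ι → ℕ) (μ κ : ℝ)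
    (hκ : ∀ j ∈ J, ((q j).natDegree : ℝ) + μ * e j ≤ κ)
    {θ : ℂ} (hθ0 : θ ≠ 0)
    (hθ : (∑ j ∈ J.filter (fun j => ((q j).natDegree : ℝ) + μ * e j = κ),
        Polynomial.C (q j).leadingCoeff * Polynomial.X ^ (e j)).eval θ = 0)
    (hQ : (∑ j ∈ J.filter (fun j => ((q j).natDegree : ℝ) + μ * e j = κ),
        Polynomial.C (q j).leadingCoeff * Polynomial.X ^ (e j)) ≠ 0)
    (ω : ℂ) (s : ℤ) (hs : s = 1 ∨ s = -1)
    (hω : R.leadingCoeff * ω ^ R.natDegree = 2 * Real.pi * I * s) :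
    ∃ t : ℕ → ℂ, Tendsto (fun k => ‖t k‖) atTop atTop ∧
      (∀ k, ∑ j ∈ J, (q j).eval (t k) * exp (R.eval (t k)) ^ (e j) = 0) ∧
      Tendsto (fun k => (R.eval (t k)).re - μ * Real.log ‖t k‖) atTop (𝓝 (Real.log ‖θ‖)) := by
  classical
  -- notation
  set Jt := J.filter (fun j => ((q j).natDegree : ℝ) + μ * e j = κ) with hJt
  set Jn := J.filter (fun j => ¬ ((q j).natDegree : ℝ) + μ * e j = κ) with hJn
  set Qμ : Polynomial ℂ := ∑ j ∈ Jt, Polynomial.C (q j).leadingCoeff * Polynomial.X ^ (e j)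
    with hQμ
  set a : ℂ := R.leadingCoeff with ha_def
  set ℓ : Polynomial ℂ := R.eraseLead with hℓ_def
  set d : ℕ := R.natDegree with hd_def
  set τ : ℂ := -(R.coeff (d - 1) / (d * a)) with hτ_def
  have hR0 : R ≠ 0 := by
    rintro rfl
    rw [hd_def, Polynomial.natDegree_zero] at hd
    omega
  have ha0 : a ≠ 0 := Polynomial.leadingCoeff_ne_zero.2 hR0
  have hapos : 0 < ‖a‖ := norm_pos_iff.2 ha0
  -- the limit function `h(u) = Q_μ(θ e^u)`
  set h : ℂ → ℂ := fun u => Qμ.eval (θ * exp u) with hh_def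
  have hh : Differentiable ℂ h :=
    (Polynomial.differentiable Qμ).comp ((differentiable_const θ).mul differentiable_exp)
  have hh0 : h 0 = 0 := by simp only [hh_def, Complex.exp_zero, mul_one]; exact hθ
  have hhne : ∃ u, h u ≠ 0 := exists_eval_mul_exp_ne_zero hQ hθ0
  -- the corrected roots on the ray, with their position
  set c₀ : ℂ := Complex.log θ with hc₀_def
  have hc₀ : exp c₀ = θ := Complex.exp_log hθ0
  obtain ⟨z₀, Lg, K₀, hz₀norm, hz₀pos, hroot⟩ := exists_ray_roots_log_pos R hd ω s hs hω μ c₀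
  rw [← hd_def, ← ha_def, ← hτ_def] at hz₀pos
  have hLz : ∀ j, exp (Lg j) = z₀ j := fun j => (hroot j).1
  have hz₀θ : ∀ j, exp (R.eval (z₀ j)) = θ * exp ((μ : ℂ) * Lg j) := fun j => by
    rw [(hroot j).2.1, hc₀]
  have hz₀1 : ∀ j, 1 ≤ ‖z₀ j‖ := fun j => (hroot j).2.2.1
  have hz₀2 : ∀ j, 2 ≤ ‖a‖ * ‖z₀ j‖ := fun j => (hroot j).2.2.2
  have hz₀ne : ∀ j, z₀ j ≠ 0 := fun j => norm_pos_iff.1 (by linarith [hz₀1 j])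
  have hReL : ∀ j, (Lg j).re = Real.log ‖z₀ j‖ := fun j => re_eq_log_norm_of_exp_eq (hLz j)
  -- the remainder constant and the local coordinates
  set K : ℝ := 1 / ‖a‖ + coeffNormSum ℓ * ((d - 1 : ℕ) : ℝ) * 2 ^ (d - 1) / ‖a‖ with hK_def
  set φ : ℕ → ℂ → ℂ := fun j u =>
    z₀ j * exp (u / ((R.natDegree : ℂ) * (R.leadingCoeff * z₀ j ^ R.natDegree))) with hφ_def
  have hRem : ∀ j (u : ℂ), ‖u‖ ≤ 1 → ‖R.eval (φ j u) - R.eval (z₀ j) - u‖ ≤ K / ‖z₀ j‖ :=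
    fun j u hu => norm_gceRem_le hd (hz₀1 j) (hz₀2 j) hu
  have hdisp' : ∀ j (u : ℂ), ‖u‖ ≤ 1 → ‖φ j u - z₀ j‖ ≤ 2 / (‖a‖ * ‖z₀ j‖ ^ (d - 1)) :=
    fun j u hu => (norm_gcePhi_sub_le (R := R) (z₀ := z₀ j) hd (hz₀1 j) (hz₀2 j) hu).1
  have hdisp : ∀ j (u : ℂ), ‖u‖ ≤ 1 → ‖φ j u - z₀ j‖ ≤ 1 := fun j u hu => by
    obtain ⟨h1, h2⟩ := norm_gcePhi_sub_le (R := R) (z₀ := z₀ j) hd (hz₀1 j) (hz₀2 j) hu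
    exact h1.trans h2
  have hlog : Tendsto (fun j => Real.log ‖z₀ j‖) atTop atTop :=
    Real.tendsto_log_atTop.comp hz₀norm
  -- coefficient ratios: `‖q_j(φ u)/z₀^{n_j} - lc(q_j)‖ ≤ K_j/‖z₀‖`
  set Kq : ι → ℝ := fun j =>
    (coeffNormSum (q j) + coeffNormSum (q j).eraseLead +
      (q j).natDegree * ‖(q j).leadingCoeff‖) * 2 ^ (q j).natDegree with hKq
  have hKq0 : ∀ j, 0 ≤ Kq j := fun j => by
    have := coeffNormSum_nonneg (q j); have := coeffNormSum_nonneg (q j).eraseLead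
    simp only [hKq]; positivity
  have hratio : ∀ j i (u : ℂ), ‖u‖ ≤ 1 →
      ‖(q j).eval (φ i u) / z₀ i ^ (q j).natDegree - (q j).leadingCoeff‖ ≤ Kq j / ‖z₀ i‖ :=
    fun j i u hu => norm_eval_div_pow_sub_coeff_le (q j) le_rfl (hz₀1 i) (hdisp i u hu)
  -- the normalisers `D_i = e^{κ L_i}` and the weights `F_{ij} = e^{(n_j + μ e_j - κ) L_i}`
  set D : ℕ → ℂ := fun i => exp ((κ : ℂ) * Lg i) with hD_def
  have hD0 : ∀ i, D i ≠ 0 := fun i => Complex.exp_ne_zero _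
  set F : ℕ → ι → ℂ := fun i j =>
    exp (((((q j).natDegree : ℝ) + μ * e j - κ : ℝ) : ℂ) * Lg i) with hF_def
  have hFtop : ∀ i, ∀ j ∈ Jt, F i j = 1 := by
    intro i j hj
    obtain ⟨_, hjt⟩ := Finset.mem_filter.1 hj
    have h0 : ((q j).natDegree : ℝ) + μ * e j - κ = 0 := by linarith
    simp only [hF_def, h0]
    simp
  have hFnorm : ∀ i j, ‖F i j‖ =
      Real.exp ((((q j).natDegree : ℝ) + μ * e j - κ) * Real.log ‖z₀ i‖) := by
    intro i j
    simp only [hF_def]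
    rw [Complex.norm_exp, Complex.re_ofReal_mul, hReL]
  have hFmul : ∀ i j, z₀ i ^ (q j).natDegree * exp ((μ : ℂ) * Lg i) ^ (e j) = F i j * D i := by
    intro i j
    simp only [hF_def, hD_def]
    rw [← hLz i, ← Complex.exp_nat_mul, ← Complex.exp_nat_mul, ← Complex.exp_add,
      ← Complex.exp_add]
    congr 1
    push_cast
    ring
  -- the rescaled functions `G_i(u) = g(φ_i(u)) / D_i`
  set g : ℂ → ℂ := fun z => ∑ j ∈ J, (q j).eval z * exp (R.eval z) ^ (e j) with hg_def
  set Gf : ℕ → ℂ → ℂ := fun i u => g (φ i u) / D i with hGf_def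
  have hgdiff : Differentiable ℂ g := by
    refine Differentiable.fun_sum fun j _ => ?_
    exact (Polynomial.differentiable _).mul ((Polynomial.differentiable R).cexp.pow _)
  have hGfdiff : ∀ i, Differentiable ℂ (Gf i) := by
    intro i
    have hφ : Differentiable ℂ (φ i) := differentiable_gcePhi R (z₀ i)
    exact (hgdiff.comp hφ).div_const _
  -- the key identity `e^{R(φ u)} = θ e^{μL} e^{u + Rem u}`
  have hkey : ∀ i (u : ℂ), exp (R.eval (φ i u)) =
      θ * exp ((μ : ℂ) * Lg i) * exp (u + (R.eval (φ i u) - R.eval (z₀ i) - u)) := by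
    intro i u
    rw [← hz₀θ i, ← Complex.exp_add]
    congr 1
    ring
  -- uniform approximation on `closedBall 0 1`
  set W : ℝ := ‖θ‖ * Real.exp 2 with hW
  have hunif : ∀ η : ℝ, 0 < η → ∀ᶠ i in atTop, ∀ u ∈ closedBall (0 : ℂ) 1, ‖Gf i u - h u‖ < η := by
    intro η hη
    have hη4 : 0 < η / 4 := by positivity
    obtain ⟨β, hβ, hβh⟩ := Metric.uniformContinuousOn_iff.1
      ((isCompact_closedBall (0 : ℂ) 2).uniformContinuousOn_of_continuous hh.continuous.continuousOn)
      (η / 4) hη4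
    have hevR : ∀ᶠ i in atTop, K / ‖z₀ i‖ < min β 1 :=
      (tendsto_const_nhds.div_atTop hz₀norm).eventually (gt_mem_nhds (lt_min hβ zero_lt_one))
    have hevT : ∀ᶠ i in atTop, (∑ j ∈ Jt, Kq j * W ^ (e j)) / ‖z₀ i‖ < η / 4 :=
      (tendsto_const_nhds.div_atTop hz₀norm).eventually (gt_mem_nhds hη4)
    have hevN : ∀ᶠ i in atTop, ∑ j ∈ Jn, (‖(q j).leadingCoeff‖ + Kq j) *
        Real.exp ((((q j).natDegree : ℝ) + μ * e j - κ) * Real.log ‖z₀ i‖) * W ^ (e j) <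
          η / 4 := by
      have hlim : Tendsto (fun i => ∑ j ∈ Jn, (‖(q j).leadingCoeff‖ + Kq j) *
          Real.exp ((((q j).natDegree : ℝ) + μ * e j - κ) * Real.log ‖z₀ i‖) * W ^ (e j))
          atTop (𝓝 0) := by
        rw [show (0 : ℝ) = ∑ j ∈ Jn, 0 by simp]
        refine tendsto_finsetSum _ fun j hj => ?_
        obtain ⟨hjJ, hjn⟩ := Finset.mem_filter.1 hj
        have hγ : ((q j).natDegree : ℝ) + μ * e j - κ < 0 := by
          rcases (hκ j hjJ).lt_or_eq with hlt | heq
          · linarith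
          · exact absurd heq hjn
        have h1 : Tendsto (fun i => Real.exp ((((q j).natDegree : ℝ) + μ * e j - κ) *
            Real.log ‖z₀ i‖)) atTop (𝓝 0) :=
          Real.tendsto_exp_atBot.comp (hlog.const_mul_atTop_of_neg hγ)
        have h2 := (h1.const_mul (‖(q j).leadingCoeff‖ + Kq j)).mul_const (W ^ (e j))
        simpa using h2
      exact hlim.eventually (gt_mem_nhds hη4)
    filter_upwards [hevR, hevT, hevN] with i hiR hiT hiN u hu
    rw [mem_closedBall, dist_zero_right] at hu
    set ρ : ℂ := R.eval (φ i u) - R.eval (z₀ i) - u with hρ_def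
    have hRem1 : ‖ρ‖ < min β 1 := (hRem i u hu).trans_lt hiR
    have hRemβ : ‖ρ‖ < β := hRem1.trans_le (min_le_left _ _)
    have hw : ‖θ * exp (u + ρ)‖ ≤ W := by
      rw [norm_mul, Complex.norm_exp, hW]
      refine mul_le_mul_of_nonneg_left (Real.exp_le_exp.2 ?_) (norm_nonneg _)
      have := re_le_norm (u + ρ)
      have := norm_add_le u ρ
      have hRem1' : ‖ρ‖ ≤ 1 := (hRem1.trans_le (min_le_right _ _)).le
      linarith
    have hz₀i1 : 1 ≤ ‖z₀ i‖ := hz₀1 i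
    -- (1) the top term
    have hQterm : ‖Qμ.eval (θ * exp (u + ρ)) - h u‖ < η / 4 := by
      have hRem1' : ‖ρ‖ ≤ 1 := (hRem1.trans_le (min_le_right _ _)).le
      have hmem1 : u + ρ ∈ closedBall (0 : ℂ) 2 := by
        rw [mem_closedBall, dist_zero_right]
        exact (norm_add_le _ _).trans (by linarith)
      have hmem2 : u ∈ closedBall (0 : ℂ) 2 := by
        rw [mem_closedBall, dist_zero_right]; linarith
      have hdist : dist (u + ρ) u < β := by
        rw [dist_eq_norm, add_sub_cancel_left]; exact hRemβ
      have := hβh _ hmem1 _ hmem2 hdist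
      rwa [dist_eq_norm] at this
    -- (2) the top coefficient-tail term
    have hTterm : ‖∑ j ∈ Jt, ((q j).eval (φ i u) / z₀ i ^ (q j).natDegree - (q j).leadingCoeff) *
        (θ * exp (u + ρ)) ^ (e j)‖ < η / 4 := by
      refine lt_of_le_of_lt ?_ hiT
      rw [Finset.sum_div]
      refine (norm_sum_le _ _).trans (Finset.sum_le_sum fun j _ => ?_)
      rw [norm_mul, norm_pow]
      calc ‖(q j).eval (φ i u) / z₀ i ^ (q j).natDegree - (q j).leadingCoeff‖ *
            ‖θ * exp (u + ρ)‖ ^ (e j)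
          ≤ Kq j / ‖z₀ i‖ * W ^ (e j) :=
            mul_le_mul (hratio j i u hu) (pow_le_pow_left₀ (norm_nonneg _) hw (e j))
              (by positivity) (div_nonneg (hKq0 j) (norm_nonneg _))
        _ = Kq j * W ^ (e j) / ‖z₀ i‖ := by ring
    -- (3) the non-top terms
    have hNterm : ‖∑ j ∈ Jn, (q j).eval (φ i u) / z₀ i ^ (q j).natDegree * F i j *
        (θ * exp (u + ρ)) ^ (e j)‖ < η / 4 := by
      refine lt_of_le_of_lt ?_ hiN
      refine (norm_sum_le _ _).trans (Finset.sum_le_sum fun j _ => ?_)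
      rw [norm_mul, norm_mul, norm_pow, hFnorm]
      have hr : ‖(q j).eval (φ i u) / z₀ i ^ (q j).natDegree‖ ≤ ‖(q j).leadingCoeff‖ + Kq j := by
        have h1 := hratio j i u hu
        have h2 := norm_le_insert' ((q j).eval (φ i u) / z₀ i ^ (q j).natDegree)
          (q j).leadingCoeff
        have h3 : Kq j / ‖z₀ i‖ ≤ Kq j := div_le_self (hKq0 j) hz₀i1
        linarith
      have hWpow : ‖θ * exp (u + ρ)‖ ^ (e j) ≤ W ^ (e j) :=
        pow_le_pow_left₀ (norm_nonneg _) hw (e j)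
      have hlc0 : 0 ≤ ‖(q j).leadingCoeff‖ + Kq j := by have := hKq0 j; positivity
      exact mul_le_mul (mul_le_mul_of_nonneg_right hr (Real.exp_nonneg _)) hWpow
        (by positivity) (by positivity)
    -- assemble: `Gf i u - h u = (top - h) + tails + non-top`
    have hterm : ∀ j ∈ J, (q j).eval (φ i u) * exp (R.eval (φ i u)) ^ (e j) / D i =
        (q j).eval (φ i u) / z₀ i ^ (q j).natDegree * F i j * (θ * exp (u + ρ)) ^ (e j) := by
      intro j _
      have hzn : z₀ i ^ (q j).natDegree ≠ 0 := pow_ne_zero _ (hz₀ne i)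
      have e1 : (q j).eval (φ i u) = (q j).eval (φ i u) / z₀ i ^ (q j).natDegree *
          z₀ i ^ (q j).natDegree := (div_mul_cancel₀ _ hzn).symm
      rw [hkey i u, ← hρ_def]
      conv_lhs => rw [e1]
      calc (q j).eval (φ i u) / z₀ i ^ (q j).natDegree * z₀ i ^ (q j).natDegree *
            (θ * exp ((μ : ℂ) * Lg i) * exp (u + ρ)) ^ (e j) / D i
          = (q j).eval (φ i u) / z₀ i ^ (q j).natDegree *
              (z₀ i ^ (q j).natDegree * exp ((μ : ℂ) * Lg i) ^ (e j)) *
              (θ * exp (u + ρ)) ^ (e j) / D i := by ring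
        _ = (q j).eval (φ i u) / z₀ i ^ (q j).natDegree * (F i j * D i) *
              (θ * exp (u + ρ)) ^ (e j) / D i := by rw [hFmul i j]
        _ = (q j).eval (φ i u) / z₀ i ^ (q j).natDegree * F i j *
              (θ * exp (u + ρ)) ^ (e j) * D i / D i := by ring
        _ = (q j).eval (φ i u) / z₀ i ^ (q j).natDegree * F i j *
              (θ * exp (u + ρ)) ^ (e j) := mul_div_cancel_right₀ _ (hD0 i)
    have hGsplit : Gf i u - h u = (Qμ.eval (θ * exp (u + ρ)) - h u) +
        (∑ j ∈ Jt, ((q j).eval (φ i u) / z₀ i ^ (q j).natDegree - (q j).leadingCoeff) *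
          (θ * exp (u + ρ)) ^ (e j)) +
        (∑ j ∈ Jn, (q j).eval (φ i u) / z₀ i ^ (q j).natDegree * F i j *
          (θ * exp (u + ρ)) ^ (e j)) := by
      have hQμe : Qμ.eval (θ * exp (u + ρ)) =
          ∑ j ∈ Jt, (q j).leadingCoeff * (θ * exp (u + ρ)) ^ (e j) := by
        rw [hQμ, Polynomial.eval_finsetSum]
        refine Finset.sum_congr rfl fun j _ => ?_
        rw [Polynomial.eval_mul, Polynomial.eval_C, Polynomial.eval_pow, Polynomial.eval_X]
      have hsum : (∑ j ∈ J, (q j).eval (φ i u) * exp (R.eval (φ i u)) ^ (e j)) / D i =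
          (∑ j ∈ Jt, (q j).eval (φ i u) / z₀ i ^ (q j).natDegree * (θ * exp (u + ρ)) ^ (e j)) +
          ∑ j ∈ Jn, (q j).eval (φ i u) / z₀ i ^ (q j).natDegree * F i j *
            (θ * exp (u + ρ)) ^ (e j) := by
        rw [Finset.sum_div, Finset.sum_congr rfl hterm,
          ← Finset.sum_filter_add_sum_filter_not J
            (fun j => ((q j).natDegree : ℝ) + μ * e j = κ)]
        congr 1
        refine Finset.sum_congr rfl fun j hj => ?_
        rw [hFtop i j hj, mul_one]
      have htails : ∑ j ∈ Jt, (q j).eval (φ i u) / z₀ i ^ (q j).natDegree *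
          (θ * exp (u + ρ)) ^ (e j) =
          (∑ j ∈ Jt, ((q j).eval (φ i u) / z₀ i ^ (q j).natDegree - (q j).leadingCoeff) *
            (θ * exp (u + ρ)) ^ (e j)) +
          ∑ j ∈ Jt, (q j).leadingCoeff * (θ * exp (u + ρ)) ^ (e j) := by
        rw [← Finset.sum_add_distrib]
        refine Finset.sum_congr rfl fun j _ => ?_
        ring
      rw [hGf_def, hg_def]
      simp only []
      rw [hsum, htails, ← hQμe]
      ring
    rw [hGsplit]
    calc ‖(Qμ.eval (θ * exp (u + ρ)) - h u) +
          (∑ j ∈ Jt, ((q j).eval (φ i u) / z₀ i ^ (q j).natDegree - (q j).leadingCoeff) *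
            (θ * exp (u + ρ)) ^ (e j)) +
          (∑ j ∈ Jn, (q j).eval (φ i u) / z₀ i ^ (q j).natDegree * F i j *
            (θ * exp (u + ρ)) ^ (e j))‖
        ≤ ‖Qμ.eval (θ * exp (u + ρ)) - h u‖ +
          ‖∑ j ∈ Jt, ((q j).eval (φ i u) / z₀ i ^ (q j).natDegree - (q j).leadingCoeff) *
            (θ * exp (u + ρ)) ^ (e j)‖ +
          ‖∑ j ∈ Jn, (q j).eval (φ i u) / z₀ i ^ (q j).natDegree * F i j *
            (θ * exp (u + ρ)) ^ (e j)‖ := norm_add₃_le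
      _ < η / 4 + η / 4 + η / 4 := by gcongr
      _ ≤ η := by linarith
  -- persistence at every radius, and zeros of minimal norm
  have hzerosε : ∀ ε : ℝ, 0 < ε → ε ≤ 1 → ∀ᶠ i in atTop, ∃ u ∈ ball (0 : ℂ) ε, Gf i u = 0 := by
    intro ε hε hε1
    refine eventually_exists_zero_of_unif_approx hh hhne hh0 hGfdiff hε fun η hη => ?_
    filter_upwards [hunif η hη] with i hi u hu
    exact hi u (closedBall_subset_closedBall hε1 hu)
  obtain ⟨K₁, hK₁⟩ := eventually_atTop.1 ((hzerosε 1 one_pos le_rfl).and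
    (hz₀norm.eventually_ge_atTop 2))
  have hsol : ∀ k : ℕ, ∃ u : ℂ, (‖u‖ ≤ 1 ∧ Gf (k + K₁) u = 0) ∧
      ∀ u' : ℂ, ‖u'‖ ≤ 1 → Gf (k + K₁) u' = 0 → ‖u‖ ≤ ‖u'‖ := by
    intro k
    obtain ⟨u₀, hu₀, hu₀0⟩ := (hK₁ (k + K₁) (Nat.le_add_left _ _)).1
    rw [mem_ball, dist_zero_right] at hu₀
    have hS : IsCompact {u : ℂ | ‖u‖ ≤ 1 ∧ Gf (k + K₁) u = 0} := by
      refine (isCompact_closedBall (0 : ℂ) 1).of_isClosed_subset ?_ ?_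
      · exact IsClosed.inter (isClosed_le continuous_norm continuous_const)
          (isClosed_eq (hGfdiff _).continuous continuous_const)
      · rintro u ⟨hu, -⟩
        rw [mem_closedBall, dist_zero_right]; exact hu
    obtain ⟨u, huS, hmin⟩ := hS.exists_isMinOn ⟨u₀, hu₀.le, hu₀0⟩ continuous_norm.continuousOn
    exact ⟨u, huS, fun u' h1 h2 => hmin ⟨h1, h2⟩⟩
  choose u hu humin using hsol
  have hu1 : ∀ k, ‖u k‖ ≤ 1 := fun k => (hu k).1
  have hu0 : ∀ k, Gf (k + K₁) (u k) = 0 := fun k => (hu k).2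
  have hz₀two : ∀ k : ℕ, 2 ≤ ‖z₀ (k + K₁)‖ := fun k => (hK₁ (k + K₁) (Nat.le_add_left _ _)).2
  -- `u_k → 0`
  have hulim : Tendsto (fun k => ‖u k‖) atTop (𝓝 0) := by
    rw [Metric.tendsto_nhds]
    intro ε hε
    have hev := (tendsto_add_atTop_nat K₁).eventually
      (hzerosε (min ε 1) (lt_min hε one_pos) (min_le_right _ _))
    filter_upwards [hev] with k hk
    obtain ⟨u', hu', hu'0⟩ := hk
    rw [mem_ball, dist_zero_right] at hu'
    rw [Real.dist_eq, sub_zero, abs_of_nonneg (norm_nonneg _)]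
    exact lt_of_le_of_lt (humin k u' (hu'.le.trans (min_le_right _ _)) hu'0)
      (hu'.trans_le (min_le_left _ _))
  refine ⟨fun k => φ (k + K₁) (u k), ?_, fun k => ?_, ?_⟩
  · -- `‖t_k‖ ≥ ‖z₀‖ - 1 → ∞`
    have h1 : Tendsto (fun k => ‖z₀ (k + K₁)‖ - 1) atTop atTop :=
      tendsto_atTop_add_const_right _ _ (hz₀norm.comp (tendsto_add_atTop_nat K₁))
    refine tendsto_atTop_mono (fun k => ?_) h1
    have := norm_sub_norm_le (z₀ (k + K₁)) (φ (k + K₁) (u k))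
    rw [norm_sub_rev] at this
    linarith [hdisp (k + K₁) (u k) (hu1 k)]
  · have h0 := hu0 k
    have : g (φ (k + K₁) (u k)) = 0 := by
      rw [hGf_def] at h0
      exact (div_eq_zero_iff.1 h0).resolve_right (hD0 _)
    simpa [hg_def] using this
  · -- the limit of the value
    have hK0 : 0 ≤ K := by
      have := coeffNormSum_nonneg ℓ
      simp only [hK_def]; positivity
    -- `Re R(z₀) = log ‖θ‖ + μ log ‖z₀‖`
    have hReRz : ∀ i, (R.eval (z₀ i)).re = Real.log ‖θ‖ + μ * Real.log ‖z₀ i‖ := by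
      intro i
      have h1 := congrArg (fun z : ℂ => ‖z‖) (hz₀θ i)
      simp only [norm_mul, Complex.norm_exp, Complex.re_ofReal_mul, hReL] at h1
      have h2 := congrArg Real.log h1
      rwa [Real.log_exp, Real.log_mul (norm_ne_zero_iff.2 hθ0) (Real.exp_pos _).ne',
        Real.log_exp] at h2
    -- (1) `R(t_k) - R(z₀) → 0`
    have hA : Tendsto (fun k => (R.eval (φ (k + K₁) (u k))).re - (R.eval (z₀ (k + K₁))).re)
        atTop (𝓝 0) := by
      have hrem : Tendsto (fun k => K / ‖z₀ (k + K₁)‖) atTop (𝓝 0) :=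
        tendsto_const_nhds.div_atTop (hz₀norm.comp (tendsto_add_atTop_nat K₁))
      have hsum : Tendsto (fun k => ‖u k‖ + K / ‖z₀ (k + K₁)‖) atTop (𝓝 0) := by
        simpa using hulim.add hrem
      refine squeeze_zero_norm (fun k => ?_) hsum
      rw [Real.norm_eq_abs, ← Complex.sub_re]
      refine (Complex.abs_re_le_norm _).trans ?_
      have e1 : R.eval (φ (k + K₁) (u k)) - R.eval (z₀ (k + K₁)) =
          u k + (R.eval (φ (k + K₁) (u k)) - R.eval (z₀ (k + K₁)) - u k) := by ring
      rw [e1]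
      exact (norm_add_le _ _).trans (add_le_add le_rfl (hRem _ _ (hu1 k)))
    -- (2) `log ‖t_k‖ - log ‖z₀‖ → 0`
    have hB : Tendsto (fun k => Real.log ‖φ (k + K₁) (u k)‖ - Real.log ‖z₀ (k + K₁)‖)
        atTop (𝓝 0) := by
      refine tendsto_log_sub_log_of_abs_sub_le (hz₀norm.comp (tendsto_add_atTop_nat K₁))
        (C := 1) (D := 0) (Eventually.of_forall fun k => ?_)
      simp only [zero_mul, add_zero]
      have h1 := hdisp (k + K₁) (u k) (hu1 k)
      have h2 := abs_norm_sub_norm_le (z₀ (k + K₁)) (φ (k + K₁) (u k))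
      rw [norm_sub_rev] at h2
      linarith
    -- assemble
    have hC := (hA.sub (hB.const_mul μ)).add_const (Real.log ‖θ‖)
    simp only [mul_zero, sub_zero, zero_add] at hC
    refine hC.congr fun k => ?_
    rw [hReRz]
    ring

end Summit.Schanuel.Schanuel.Theorems
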